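import Literature.Probability.Percolation.KSTPeriodicStatements
import Literature.Probability.Percolation.KSTPeriodicSymmetry
import Literature.Probability.Percolation.KSTPeriodicCascade
import Literature.Probability.Percolation.RSWProofs
import HarnessLib

/-!
# KST-type RSW for periodic measures: assembly of the weak theorem

Topic `Literature/Probability/Percolation`. The weak periodic Russo–Seymour–Welsh theorem
`WeakPeriodicRSW k t` (`KSTPeriodicStatements.lean`) follows from the four probabilistic steps of
[KohlerSchindlerTassion2023] — arms from short crossings (Lemma 1(ii)), quasi-crossings from arms
(Lemma 3), the closing and cascading inequalities (Lemmas 5 and 4) — by the cascading argument in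
constant form (`cascade_bound`, `KSTPeriodicCascade.lean`) along the tower of scales
`mᵢ = M₀ · 4ⁱ`, the base bridge bound being supplied by the row finite-energy hypothesis, and
bridges giving long crossings (Lemma 1(i),(iii)). This file proves that implication
(`weakPeriodicRSW_of`) together with the bookkeeping it needs: monotonicity of `𝓒_t(m, n)` in the
rectangle (narrower and taller is easier, `real_crossing_mono`), translation of the row-segment
event, and "an open row segment across the box is a bridge".

## References

* [KohlerSchindlerTassion2023] L. Köhler-Schindler, V. Tassion, Duke Math. J. 172 (2023), §2, §5.2.
-/

namespace Literature.Probability.Percolation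

open _root_.MeasureTheory LatticeModels

noncomputable section

namespace KSTPeriodic

/-! ### Monotonicity of rectangle crossings -/

/-- For a lattice configuration, a left–right crossing of a rectangle contains one of any
narrower and taller rectangle between the same kind of columns: `lrRect a b c d ⊆ lrRect a' b' c' d'`
for `a ≤ a' ≤ b' ≤ b`, `c' ≤ c`, `d ≤ d'` (first visit to the column `b'`, then last visit to the
column `a'` before it; `exists_openConnIn_column`, `exists_openConnIn_column_ge`).
[cite: KohlerSchindlerTassion2023, §5.2 (by inclusion of events)] -/
theorem lrRect_subset_lrRect {ω : BondConfig (Site 2)} (hω : ω ⊆ (zdGraph 2).edgeSet)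
    {a b c d a' b' c' d' : ℤ} (ha : a ≤ a') (hab : a' ≤ b') (hb : b' ≤ b) (hc : c' ≤ c) (hd : d ≤ d')
    (h : ω ∈ lrRect a b c d) : ω ∈ lrRect a' b' c' d' := by
  obtain ⟨x, hx, y, hy, hxy⟩ := h
  have hx0 : x 0 = a := hx.2
  have hy0 : y 0 = b := hy.2
  -- widen the rows
  have h1 : ω ∈ openConnIn (rect a b c' d') x y :=
    openConnIn_mono (rect_mono le_rfl le_rfl hc hd) x y hxy
  -- first visit to the column `b'`
  obtain ⟨z, hz0, hxz⟩ := exists_openConnIn_column hω b' (by omega) (by omega) h1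
  -- last visit to the column `a'` before it
  rw [openConnIn_comm] at hxz
  obtain ⟨z', hz'0, hzz'⟩ := exists_openConnIn_column_ge hω a' (by omega) (by omega) hxz
  rw [openConnIn_comm] at hzz'
  have hsub : (rect a b c' d' ∩ {v : Site 2 | v 0 ≤ b'}) ∩ {v : Site 2 | a' ≤ v 0} ⊆ rect a' b' c' d' := by
    rintro v ⟨⟨hv, hv1⟩, hv2⟩
    simp only [mem_rect, Set.mem_setOf_eq] at hv hv1 hv2 ⊢
    omega
  obtain ⟨hz'S, hzS, _⟩ := id hzz'
  exact ⟨z', ⟨hsub hz'S, hz'0⟩, z, ⟨hsub hzS, hz0⟩, openConnIn_mono hsub z' z hzz'⟩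

/-- `𝓒_t(m, n)` is monotone in the rectangle for lattice configurations: narrower (`m' ≤ m`) and
taller (`n ≤ n'`) rectangles are easier to cross. [cite: KohlerSchindlerTassion2023, §5.2 (by inclusion of events)] -/
theorem crossing_subset_crossing {ω : BondConfig (Site 2)} (hω : ω ⊆ (zdGraph 2).edgeSet)
    {t m n m' n' : ℕ} (hm : m' ≤ m) (hn : n ≤ n') (h : ω ∈ crossing t m n) : ω ∈ crossing t m' n' :=
  lrRect_subset_lrRect hω (by omega) (by omega) (by omega) (by omega) (by omega) h

/-- Probability form of `crossing_subset_crossing` for a measure carried by lattice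
configurations. [cite: KohlerSchindlerTassion2023, §5.2 (by inclusion of events)] -/
theorem real_crossing_mono {μ : Measure (BondConfig (Site 2))} [IsFiniteMeasure μ]
    (hL : LatticeCarried μ) {t m n m' n' : ℕ} (hm : m' ≤ m) (hn : n ≤ n') :
    μ.real (crossing t m n) ≤ μ.real (crossing t m' n') := by
  refine ENNReal.toReal_mono (measure_ne_top _ _) (measure_mono_ae ?_)
  filter_upwards [hL] with ω hω h using crossing_subset_crossing hω hm hn h

/-! ### Row segments -/

/-- The event that the horizontal segment of length `L` starting at `(a, y)` is open. [folklore] -/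
theorem measurableSet_rowSegment (a y : ℤ) (L : ℕ) :
    MeasurableSet {ω : BondConfig (Site 2) | ∀ i : ℕ, i < L → s(![a + i, y], ![a + i + 1, y]) ∈ ω} := by
  have : {ω : BondConfig (Site 2) | ∀ i : ℕ, i < L → s(![a + i, y], ![a + i + 1, y]) ∈ ω} =
      ⋂ i ∈ Finset.range L, {ω : BondConfig (Site 2) | s(![a + i, y], ![a + i + 1, y]) ∈ ω} := by
    ext ω; simp
  rw [this]
  exact Finset.measurableSet_biInter _ fun i _ => (measurable_set_mem _).setOf

/-- An open row segment joins its endpoints inside any set containing it. [folklore] -/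
theorem openConnIn_of_rowSegment {ω : BondConfig (Site 2)} {S : Set (Site 2)} {a y : ℤ} {L : ℕ}
    (hS : ∀ i : ℕ, i ≤ L → (![a + i, y] : Site 2) ∈ S)
    (h : ∀ i : ℕ, i < L → s(![a + i, y], ![a + i + 1, y]) ∈ ω) :
    ω ∈ openConnIn S (![a, y]) (![a + L, y]) := by
  induction L with
  | zero => simpa using openConnIn_refl (ω := ω) (hS 0 le_rfl)
  | succ L ih =>
    have h1 : ω ∈ openConnIn S (![a, y]) (![a + L, y]) :=
      ih (fun i hi => hS i (by omega)) fun i hi => h i (by omega)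
    have h2 : ω ∈ openConnIn S (![a + L, y]) (![a + (L + 1 : ℕ), y]) := by
      have he := h L (by omega)
      have hne : (![a + L, y] : Site 2) ≠ ![a + L + 1, y] := by
        intro heq; have := congr_fun heq 0; simp at this
      have hS' : (![a + L + 1, y] : Site 2) ∈ S := by simpa [add_assoc] using hS (L + 1) le_rfl
      have := openConnIn_of_adj (hS L (by omega)) hS' he hne
      simpa [Nat.cast_succ, add_assoc] using this
    exact PlanarDuality.openConnIn_trans h1 h2

/-- An open row segment across the bridge box on one of its rows realises the bridge event.
[cite: KohlerSchindlerTassion2023, §5.2 (the scale m₀ is well-defined)] -/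
theorem bridge_of_rowSegment {ω : BondConfig (Site 2)} {t b n : ℕ} {y : ℤ}
    (hy1 : -(n : ℤ) - t ≤ y) (hy2 : y ≤ n)
    (h : ∀ i : ℕ, i < 2 * (n + b) + t →
      s(![-((n : ℤ) + b) - t + i, y], ![-((n : ℤ) + b) - t + i + 1, y]) ∈ ω) :
    ω ∈ bridge t b n := by
  have hconn := openConnIn_of_rowSegment (S := rect (-((n : ℤ) + b) - t) (n + b) (-(n : ℤ) - t) n)
    (a := -((n : ℤ) + b) - t) (y := y) (L := 2 * (n + b) + t) (fun i hi => by
      simp only [mem_rect, Matrix.cons_val_zero, Matrix.cons_val_one]; omega) h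
  refine ⟨![-((n : ℤ) + b) - t, y], ?_, ![-((n : ℤ) + b) - t + (2 * (n + b) + t : ℕ), y], ?_, hconn⟩
  · refine ⟨?_, Or.inl ?_⟩
    · simp only [mem_rect, Matrix.cons_val_zero, Matrix.cons_val_one]; omega
    · simp
  · refine ⟨?_, Or.inl ?_⟩
    · simp only [mem_rect, Matrix.cons_val_zero, Matrix.cons_val_one]; push_cast; omega
    · simp only [Matrix.cons_val_zero]; push_cast; ring

/-- Translating the row-segment event by a vector of `kℤ²` does not change its probability.
[cite: KohlerSchindlerTassion2023, §1 Symmetries] -/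
theorem real_rowSegment_shift {k t : ℕ} {μ : Measure (BondConfig (Site 2))} (hμ : Admissible k t μ)
    (v : Site 2) (a y : ℤ) (L : ℕ) :
    μ.real {ω | ∀ i : ℕ, i < L → s(![a + k * v 0 + i, y + k * v 1], ![a + k * v 0 + i + 1, y + k * v 1]) ∈ ω} =
      μ.real {ω | ∀ i : ℕ, i < L → s(![a + i, y], ![a + i + 1, y]) ∈ ω} := by
  have hmeas := measurableSet_rowSegment (a + k * v 0) (y + k * v 1) L
  conv_lhs => rw [← hμ.shift_inv v]
  rw [measureReal_def, Measure.map_apply (KST2023.act _).measurable hmeas, ← measureReal_def]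
  congr 1
  ext ω
  simp only [Set.mem_preimage, Set.mem_setOf_eq]
  refine forall₂_congr fun i _ => ?_
  rw [show (![a + k * v 0 + i, y + k * v 1] : Site 2) = Site.shift ((k : ℤ) • v) ![a + i, y] by
      ext j; fin_cases j
      · simp; ring
      · simp,
    show (![a + k * v 0 + i + 1, y + k * v 1] : Site 2) = Site.shift ((k : ℤ) • v) ![a + i + 1, y] by
      ext j; fin_cases j
      · simp; ring
      · simp]
  exact mk_mem_relabel_iff _ ω _ _

/-! ### The assembly -/

/-- **The weak periodic RSW theorem from its four steps** ([KohlerSchindlerTassion2023], proof of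
Theorem 1 in §5.2, run with constants as in §2): arms from short crossings, quasi-crossings from
arms, the closing and cascading inequalities, and long crossings from bridges imply
`WeakPeriodicRSW k t`. The cascade runs along the scales `M₀ · 4ⁱ`; its base bridge bound comes
from the row finite-energy hypothesis (an open row segment across the base box is a bridge).
[cite: KohlerSchindlerTassion2023, Theorem 1, §2 and §5.2] -/
theorem weakPeriodicRSW_of {k t : ℕ} (hk : 1 ≤ k) (hA : ArmsOfShortCrossings k t)
    (hQ : QuasiOfArms k t) (hC : ClosingIneq k t) (hS : CascadeStep k t)
    (hB : BridgesGiveCrossings k t) : WeakPeriodicRSW k t := by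
  intro ε p₀ hε hp₀ N₀ ρ hρ
  -- Lemma 1(ii): arms
  obtain ⟨a₀, ha₀, N₁, hA'⟩ := hA ε hε N₀
  -- Lemma 3: quasi-crossings between adjacent scales
  obtain ⟨s₀, hs₀, N₂, hQ'⟩ := hQ a₀ ha₀ N₁
  -- the base scale: a multiple of `1536 k` above every threshold
  set M₀ : ℕ := 1536 * k * (N₀ + N₁ + N₂ + k + 1) with hM₀
  have hMpos : 1 ≤ M₀ := by
    have : 1 ≤ 1536 * k * (N₀ + N₁ + N₂ + k + 1) := Nat.one_le_iff_ne_zero.2 (by positivity)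
    simpa [hM₀] using this
  have hMdiv : 1536 * k ∣ M₀ := ⟨N₀ + N₁ + N₂ + k + 1, by rw [hM₀]⟩
  have hMge : N₀ + N₁ + N₂ + k + 1 ≤ M₀ := by
    rw [hM₀]; exact Nat.le_mul_of_pos_left _ (by omega)
  -- the scales `mᵢ = M₀ 4ⁱ`
  let sc : ℕ → ℕ := fun i => M₀ * 4 ^ i
  have hsc_div : ∀ i, 1536 * k ∣ sc i := fun i => Dvd.dvd.mul_right hMdiv _
  have hsc_ge : ∀ i, M₀ ≤ sc i := fun i => Nat.le_mul_of_pos_right _ (by positivity)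
  have hsc_succ : ∀ i, sc (i + 1) = 4 * sc i := fun i => by simp only [sc, pow_succ]; ring
  have hsc_mono : ∀ {i j}, i ≤ j → sc i ≤ sc j := fun h => Nat.mul_le_mul_left _ (Nat.pow_le_pow_right (by norm_num) h)
  -- cascade constants
  set s₁ : ℝ := min s₀ 1 with hs₁
  have hs₁pos : 0 < s₁ := lt_min hs₀ one_pos
  have hs₁le : s₁ ≤ 1 := min_le_right _ _
  set θ₀ : ℝ := 1 - Real.sqrt (1 - s₁) with hθ₀
  have hθ₀pos : 0 < θ₀ := theta_pos hs₁pos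
  set L₀ : ℕ := 2 * (M₀ + M₀ / 12) + t with hL₀
  set pb : ℝ := p₀ ^ L₀ with hpb
  have hpbpos : 0 < pb := pow_pos hp₀ _
  set cb : ℝ := θ₀ * min (θ₀ ^ 2 / 4) pb with hcb
  have hcbpos : 0 < cb := mul_pos hθ₀pos (lt_min (by positivity) hpbpos)
  -- Lemma 1(i),(iii): long crossings from bridges, at aspect ratio `4ρ`
  obtain ⟨c₀, hc₀, hB'⟩ := hB cb hcbpos (4 * ρ) (by omega)
  refine ⟨c₀, hc₀, M₀, fun μ _ hμ hLμ hcross hrow N hN => ?_⟩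
  -- the given data at this measure
  have harm : ∀ n : ℕ, N₁ ≤ n → 64 * k ∣ n → a₀ ≤ μ.real (arm t (n / 64) n) := hA' μ hμ hLμ hcross
  have hquasi : ∀ m : ℕ, N₂ ≤ m → 1536 * k ∣ m → s₀ ≤ μ.real (quasi t (m + k) (4 * m) (m / 12) m) :=
    hQ' μ hμ hLμ harm
  -- the sequences of the cascade
  let q : ℕ → ℕ → ℝ := fun i j => μ.real (quasi t (sc i / 4 + k) (sc i) (sc j / 12) (sc j))
  let b : ℕ → ℝ := fun i => μ.real (bridge t (sc i / 12) (sc i))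
  have hq0 : ∀ i j, 0 ≤ q i j := fun i j => measureReal_nonneg
  have hb0 : ∀ i, 0 ≤ b i := fun i => measureReal_nonneg
  -- (P1) adjacent quasi-crossings
  have hP1 : ∀ i, s₁ ≤ q (i + 1) i := by
    intro i
    have hN₂ : N₂ ≤ sc i := by have := hsc_ge i; omega
    have h := hquasi (sc i) hN₂ (hsc_div i)
    have h4 : sc (i + 1) / 4 = sc i := by rw [hsc_succ]; omega
    simp only [q]
    rw [h4, hsc_succ]
    exact (min_le_left _ _).trans h
  -- divisibility by `12 k` and `12`
  have h12k : ∀ i, 12 * k ∣ sc i := fun i => Dvd.dvd.trans ⟨128, by ring⟩ (hsc_div i)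
  have h12 : ∀ i, 12 ∣ sc i := fun i => Dvd.dvd.trans ⟨k, by ring⟩ (h12k i)
  -- (P2) cascading
  have hP2 : ∀ i l j, j ≤ l → l ≤ i →
      (1 - Real.sqrt (1 - q i l)) ≤ q i j ∨ (1 - Real.sqrt (1 - q i l)) * q l j ≤ 1 - (1 - b l) ^ 2 :=
    fun i l j hjl hli => hS μ hμ hLμ (sc i) (sc l) (sc j) (hsc_mono hjl) (hsc_mono hli) (h12k j) (h12k l) (h12k i)
  -- (P3) closing
  have hP3 : ∀ i j, j ≤ i → q i j * b j ≤ b i :=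
    fun i j hji => hC μ hμ hLμ (sc i) (sc j) (hsc_mono hji) (h12 j) (h12 i)
  -- base: an open row segment across the base bridge box
  have hbase : pb ≤ b 0 := by
    obtain ⟨y, hy⟩ := hrow
    -- move the row `y` into `[-M₀ - t, M₀]` by a translation of `kℤ²`
    obtain ⟨j, hj1, hj2⟩ : ∃ j : ℤ, -(M₀ : ℤ) - t ≤ y + k * j ∧ y + k * j ≤ M₀ := by
      have hk0 : (k : ℤ) ≠ 0 := by exact_mod_cast (show k ≠ 0 by omega)
      have hkpos : (0 : ℤ) < k := by exact_mod_cast (show 0 < k by omega)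
      have hkM : (k : ℤ) ≤ M₀ := by exact_mod_cast (show k ≤ M₀ by omega)
      refine ⟨-(y / k), ?_, ?_⟩
      · have h1 := Int.emod_nonneg y hk0
        have h2 := Int.emod_add_mul_ediv y k
        nlinarith
      · have h1 := Int.emod_lt_of_pos y hkpos
        have h2 := Int.emod_add_mul_ediv y k
        nlinarith
    have hshift := real_rowSegment_shift hμ ![0, j] (-((M₀ : ℤ) + M₀ / 12) - t) y L₀
    simp only [Matrix.cons_val_zero, mul_zero, add_zero, Matrix.cons_val_one] at hshift
    have hseg := hy (-((M₀ : ℤ) + M₀ / 12) - t) L₀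
    rw [← hshift] at hseg
    refine hseg.trans (measureReal_mono ?_)
    intro ω hω
    have hsc0 : sc 0 = M₀ := by simp [sc]
    simp only [hsc0]
    refine bridge_of_rowSegment (y := y + k * j) hj1 hj2 ?_
    intro i hi
    have := hω i (by rw [hL₀]; omega)
    push_cast at this ⊢
    exact this
  -- the cascade
  have hcas : ∀ i, cb ≤ b i := fun i =>
    cascade_bound hs₁pos hs₁le hq0 hb0 hP1 hP2 hP3 hpbpos.le hbase i
  -- the scale `mᵢ ≤ N < 4 mᵢ`
  obtain ⟨i, hi1, hi2⟩ : ∃ i, sc i ≤ N ∧ N < 4 * sc i := by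
    classical
    have hex : ∃ i, N < 4 * sc i := by
      refine ⟨N, ?_⟩
      have : N < 4 ^ (N + 1) :=
        (Nat.lt_pow_self (by norm_num)).trans (Nat.pow_lt_pow_right (by norm_num) (by omega))
      calc N < 4 ^ (N + 1) := this
        _ = 4 * 4 ^ N := by ring
        _ ≤ 4 * (M₀ * 4 ^ N) := Nat.mul_le_mul_left _ (Nat.le_mul_of_pos_left _ (by omega))
    refine ⟨Nat.find hex, ?_, Nat.find_spec hex⟩
    by_cases h0 : Nat.find hex = 0
    · have : sc (Nat.find hex) = M₀ := by rw [h0]; simp [sc]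
      omega
    · have hpos : 0 < Nat.find hex := Nat.pos_of_ne_zero h0
      have hprev : ¬ (N < 4 * sc (Nat.find hex - 1)) := Nat.find_min hex (by omega)
      have heq : sc (Nat.find hex) = 4 * sc (Nat.find hex - 1) := by
        rw [← hsc_succ, Nat.sub_add_cancel hpos]
      omega
  -- long crossing at scale `mᵢ`, then monotonicity
  have h768 : 768 * k ∣ sc i := Dvd.dvd.trans ⟨2, by ring⟩ (hsc_div i)
  have hlong : c₀ ≤ μ.real (crossing t (4 * ρ * sc i) (sc i)) :=
    hB' μ hμ hLμ (sc i) (hMpos.trans (hsc_ge i)) h768 (hcas i)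
  refine hlong.trans (real_crossing_mono hLμ ?_ hi1)
  nlinarith

end KSTPeriodic

end

end Literature.Probability.Percolation
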